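import Summits.ResolutionOfSingularities.ResolutionOfSingularities.Theorems.PAlterationPialtFrobenius
import Summits.ResolutionOfSingularities.ResolutionOfSingularities.Theorems.PAlterationPialtNormalizationInConverse
import Summits.ResolutionOfSingularities.ResolutionOfSingularities.Theorems.PAlterationPialtReductions
import Summits.ResolutionOfSingularities.ResolutionOfSingularities.Theorems.PAlterationPialtKnownCases
import Literature.AlgebraicGeometry.Morphisms.NagataCompactification
import HarnessLib

/-!
# Stub-ideation k3 (FAMILY 3 — probe the extremes) for `stub_radicialPatching` of crux `Pialt`

Scratch signatures of the helper lemmas proposed in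
`Cruxes/Pialt/STUB-IDEAS-stub_radicialPatching-3.md`. Nothing is proved here (`sorry`);
the point is that every statement elaborates over existing declarations.
-/

set_option linter.dupNamespace false

noncomputable section

open CategoryTheory CategoryTheory.Limits AlgebraicGeometry TopologicalSpace
open Literature.AlgebraicGeometry.Resolution

namespace Summit.ResolutionOfSingularities.ResolutionOfSingularities.Cruxes.Pialt.StubIdeas3

/-- The conclusion of the crux / of the stub at one scheme (verbatim the stub's `∃ Z' g, …`). -/
def PialtAt (Z : Scheme.{0}) : Prop :=
  ∃ (Z' : Scheme.{0}) (g : Z' ⟶ Z), IsProper g ∧ IsIntegral Z' ∧ Scheme.IsRegular Z' ∧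
    Function.Surjective g.base ∧ ∃ U : Z.Opens, Dense (U : Set Z) ∧ IsFinite (g ∣_ U) ∧
      UniversallyInjective (g ∣_ U)

/-- Radicially regular (the stub's local witness shape). -/
def RR (Z : Scheme.{0}) : Prop :=
  ∃ (W : Scheme.{0}) (h : W ⟶ Z), IsIntegral W ∧ Scheme.IsRegular W ∧ IsFinite h ∧
    UniversallyInjective h ∧ Function.Surjective h.base

/-- Normality, as in the stub. -/
def Normal (Z : Scheme.{0}) : Prop := ∀ z : Z, IsIntegrallyClosed (Z.presheaf.stalk z)

/-- R1 — TWO-PIECE GLUING WITH A REGULAR PATCH (the residual of the plan). -/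
def GlueRegular (p : ℕ) (k : Type) [Field k] [CharP k p] : Prop :=
  ∀ (Z : Scheme.{0}) (f : Z ⟶ Spec (.of k)), IsSeparated f → LocallyOfFiniteType f →
    QuasiCompact f → IsIntegral Z → Normal Z →
    ∀ (V U : Z.Opens), V ⊔ U = ⊤ → PialtAt V → Scheme.IsRegular U → PialtAt Z

/-- Two-piece gluing with a radicially regular patch. -/
def GlueRR (p : ℕ) (k : Type) [Field k] [CharP k p] : Prop :=
  ∀ (Z : Scheme.{0}) (f : Z ⟶ Spec (.of k)), IsSeparated f → LocallyOfFiniteType f →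
    QuasiCompact f → IsIntegral Z → Normal Z →
    ∀ (V U : Z.Opens), V ⊔ U = ⊤ → PialtAt V → RR U → PialtAt Z

/-- H1 — INDUCTION ON A FINITE RR COVER: two-piece gluing implies the stub (conclusion is
`PialtAt Z`, definitionally the stub's conclusion). Finite subcover of the LRR cover by
quasi-compactness, induction on the number of charts, base case
`RadiciallyRegular.pialtShape_of_radiciallyRegular`; opens of `Z` are again normal integral
separated of finite type. -/
theorem radicialPatching_of_glueRR (p : ℕ) (hp : p.Prime) (k : Type) [Field k] [CharP k p]
    [PerfectField k] (hglue : GlueRR p k) (Z : Scheme.{0}) (f : Z ⟶ Spec (.of k))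
    [IsSeparated f] [LocallyOfFiniteType f] [QuasiCompact f] [IsIntegral Z] (hN : Normal Z)
    (hL : ∀ z : Z, ∃ U : Z.Opens, z ∈ U ∧ RR U) : PialtAt Z := by
  sorry

/-- H2' — EXTENDING A NORMAL RADICIAL COVER OF AN OPEN: the normalisation `Z₁ := Z^{K(W)}` of
`Z` in the function field of `W` is finite (E. Noether), radicial, surjective, normal, and
restricts over `U` to `W` (`exists_isIso_comparison_of_normal`). -/
theorem exists_finite_cover_extending (p : ℕ) (hp : p.Prime) (k : Type) [Field k] [CharP k p]
    (Z : Scheme.{0}) (f : Z ⟶ Spec (.of k)) [LocallyOfFiniteType f] [IsIntegral Z]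
    (hN : Normal Z) (U : Z.Opens) (W : Scheme.{0}) [IsIntegral W] (h : W ⟶ (U : Scheme.{0}))
    [IsFinite h] [UniversallyInjective h] (hsurj : Function.Surjective h.base) (hW : Normal W) :
    ∃ (Z₁ : Scheme.{0}) (π : Z₁ ⟶ Z), IsIntegral Z₁ ∧ Normal Z₁ ∧ IsFinite π ∧
      UniversallyInjective π ∧ Function.Surjective π.base ∧
      ∃ e : (↑(π ⁻¹ᵁ U) : Scheme.{0}) ⟶ W, IsIso e ∧ e ≫ h = π ∣_ U := by
  sorry

/-- H2 — RR PATCH ⇒ REGULAR PATCH: pass to `Z₁` of H2' (`π⁻¹ U ≅ W` regular), ascend the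
witness on `V` (`pialtConclusion_of_finite_universallyInjective_surjective_perfectField`), glue
on `Z₁`, descend (`pialtConclusion_of_finite_universallyInjective_surjective`). -/
theorem glueRR_of_glueRegular (p : ℕ) (hp : p.Prime) (k : Type) [Field k] [CharP k p]
    [PerfectField k] (hglue : GlueRegular p k) : GlueRR p k := by
  sorry

/-- H3 — WITNESSES GLUE ALONG AN ISOMORPHISM OVER THE OVERLAP (pushout of schemes along open
immersions, Mathlib; properness / finiteness / radiciality are Zariski-local on the target). -/
theorem pialtAt_of_glue (Z : Scheme.{0}) [IsIntegral Z] (V U : Z.Opens) (hVU : V ⊔ U = ⊤)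
    (V' : Scheme.{0}) (g₁ : V' ⟶ (V : Scheme.{0})) [IsProper g₁] [IsIntegral V']
    (hr₁ : Scheme.IsRegular V') (hs₁ : Function.Surjective g₁.base)
    (O : (V : Scheme.{0}).Opens) (hO : Dense (O : Set (V : Scheme.{0})))
    [IsFinite (g₁ ∣_ O)] [UniversallyInjective (g₁ ∣_ O)]
    (U' : Scheme.{0}) (g₂ : U' ⟶ (U : Scheme.{0})) [IsProper g₂] [IsIntegral U']
    (hr₂ : Scheme.IsRegular U') (hs₂ : Function.Surjective g₂.base)
    (e : (↑(g₁ ⁻¹ᵁ (V.ι ⁻¹ᵁ U)) : Scheme.{0}) ⟶ (↑(g₂ ⁻¹ᵁ (U.ι ⁻¹ᵁ V)) : Scheme.{0})) [IsIso e]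
    (he : e ≫ (g₂ ⁻¹ᵁ (U.ι ⁻¹ᵁ V)).ι ≫ g₂ ≫ U.ι = (g₁ ⁻¹ᵁ (V.ι ⁻¹ᵁ U)).ι ≫ g₁ ≫ V.ι) :
    PialtAt Z := by
  sorry

/-- H4 — CODIMENSION-ONE POINTS ABSORB FOR FREE: a witness on `V` extends across any point
`η ∉ V` whose local ring has dimension one (a DVR, `Z` normal): `Z^M` is regular near the point
over `η` (one-dimensional normal Noetherian local domain), the witness `V' → V^M` is finite — hence
an isomorphism — over a neighbourhood of `η` (Zariski main theorem, Mathlib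
`IsFinite.of_isProper_of_locallyQuasiFinite`), glue by H3. So WLOG `codim (Z ∖ V) ≥ 2`. -/
theorem absorb_codim_one (p : ℕ) (hp : p.Prime) (k : Type) [Field k] [CharP k p] [PerfectField k]
    (Z : Scheme.{0}) (f : Z ⟶ Spec (.of k)) [IsSeparated f] [LocallyOfFiniteType f]
    [QuasiCompact f] [IsIntegral Z] (hN : Normal Z) (V : Z.Opens) (hV : PialtAt V) (η : Z)
    (hη : ringKrullDim (Z.presheaf.stalk η) = 1) :
    ∃ V₁ : Z.Opens, V ≤ V₁ ∧ η ∈ V₁ ∧ PialtAt V₁ := by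
  sorry

/-- SR — STRONG RESOLUTION OF PURELY INSEPARABLE ALTERATIONS OF REGULAR VARIETIES, relative to a
regular open (OPEN from dimension 4; contains `Picover`): the natural sufficient condition for R1. -/
def SR (p : ℕ) (k : Type) [Field k] [CharP k p] : Prop :=
  ∀ (W Y : Scheme.{0}) (f : W ⟶ Spec (.of k)) (φ : Y ⟶ W), IsSeparated f → LocallyOfFiniteType f →
    QuasiCompact f → IsIntegral W → Scheme.IsRegular W → IsIntegral Y → IsProper φ →
    Function.Surjective φ.base →
    (∃ U : W.Opens, Dense (U : Set W) ∧ IsFinite (φ ∣_ U) ∧ UniversallyInjective (φ ∣_ U)) →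
    ∀ Ω : Y.Opens, Scheme.IsRegular Ω →
      ∃ (R : Scheme.{0}) (π : R ⟶ Y), IsProper π ∧ IsBirational π ∧ IsIntegral R ∧
        Scheme.IsRegular R ∧ IsIso (π ∣_ Ω)

/-- R1 from SR: compactify `V'|_{V ∩ U} → U` (Nagata, named fact in tree), resolve the
compactification `Ū` by SR without touching `Ū|_{V∩U} = V'|_{V∩U}`, glue by H3. -/
theorem glueRegular_of_SR (p : ℕ) (hp : p.Prime) (k : Type) [Field k] [CharP k p] [PerfectField k]
    (hNag : Literature.AlgebraicGeometry.Morphisms.NagataCompactification.{0}) (hSR : SR p k) :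
    GlueRegular p k := by
  sorry

/-- ASSEMBLY: the stub (pointwise, `PialtAt` = its conclusion) from R1. -/
theorem radicialPatching_of_glueRegular (p : ℕ) (hp : p.Prime) (k : Type) [Field k] [CharP k p]
    [PerfectField k] (hglue : GlueRegular p k) (Z : Scheme.{0}) (f : Z ⟶ Spec (.of k))
    [IsSeparated f] [LocallyOfFiniteType f] [QuasiCompact f] [IsIntegral Z] (hN : Normal Z)
    (hL : ∀ z : Z, ∃ U : Z.Opens, z ∈ U ∧ RR U) : PialtAt Z :=
  radicialPatching_of_glueRR p hp k (glueRR_of_glueRegular p hp k hglue) Z f hN hL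

/-- Sanity: `PialtAt`/`RR`/`Normal` unfold to the stub's binders, so the assembly has literally
the stub's type. -/
example (p : ℕ) (hp : p.Prime) (k : Type) [Field k] [CharP k p] [PerfectField k]
    (hglue : GlueRegular p k) (Z : Scheme.{0}) (f : Z ⟶ Spec (.of k)) [IsSeparated f]
    [LocallyOfFiniteType f] [QuasiCompact f] [IsIntegral Z]
    (hN : ∀ z : Z, IsIntegrallyClosed (Z.presheaf.stalk z))
    (hL : ∀ z : Z, ∃ U : Z.Opens, z ∈ U ∧ ∃ (W : Scheme.{0}) (h : W ⟶ (U : Scheme.{0})),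
      IsIntegral W ∧ Scheme.IsRegular W ∧ IsFinite h ∧ UniversallyInjective h ∧
        Function.Surjective h.base) :
    ∃ (Z' : Scheme.{0}) (g : Z' ⟶ Z), IsProper g ∧ IsIntegral Z' ∧ Scheme.IsRegular Z' ∧
      Function.Surjective g.base ∧ ∃ U : Z.Opens, Dense (U : Set Z) ∧ IsFinite (g ∣_ U) ∧
        UniversallyInjective (g ∣_ U) :=
  radicialPatching_of_glueRegular p hp k hglue Z f hN hL

end Summit.ResolutionOfSingularities.ResolutionOfSingularities.Cruxes.Pialt.StubIdeas3

end
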